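import Mathlib.InformationTheory.Hamming
import Mathlib.Algebra.Ring.BooleanRing
import Mathlib.Data.Nat.Choose.Basic
import Mathlib.Data.Finset.Powerset
import Mathlib.Algebra.Group.Nat.Even
import Literature.Computability.Complexity.ConstantDepth
import Literature.Computability.Complexity.ACRealizeOver
import HarnessLib

/-!
# The Parity Halving, Relaxed Parity Halving, Parity Bending and modular relation problems

The search ("relation") problems used in the unconditional separations between constant-depth
quantum circuits (`QNC⁰`, possibly with a quantum advice state) and constant-depth classical
circuit classes (`NC⁰`, `AC⁰`, `AC⁰[p]`) of Watts–Kothari–Schaeffer–Tal (STOC 2019),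
Grilo–Kashefi–Markham–de Oliveira (2024) and Grewal–Kumar (2024), stated as printed, as relations
between Boolean input strings and Boolean output strings, together with the elementary
observation (Watts et al. 2019, §1.1) that decides the `AC⁰[2]`-status of Parity Halving:
the parity of the `C(n,2)` pairwise conjunctions `xᵢ ∧ xⱼ` equals `⌊|x|/2⌋ mod 2` on even-weight
inputs, so a single unbounded fan-in parity gate over one layer of fan-in-2 `AND` gates solves
the Parity Halving Problem, and hence (with the side string `d = 0`) every Relaxed Parity Halving
Problem.

## Contents

* `parityHalvingRel x` — the Parity Halving Problem `PHP_{n,m}` (WKST Problem 1): valid outputs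
  `y` for an input `x` (promised to have even Hamming weight): `|y| ≡ |x|/2 (mod 2)`.
* `relaxedParityHalvingRel ends x` — the Relaxed Parity Halving Problem for a graph `G = (V, E)`
  (WKST Problem 2; the Grid-RPHP, Problem 3, is the instance `G` = a spanning tree of the grid):
  outputs `(y, d)` with `∃ z, (∀ e = (u,v) ∈ E, z_u ⊕ z_v = d_e) ∧ |y| ≡ |x|/2 + ⟨z, x⟩ (mod 2)`.
* `parityBendingRel x` — the Parity Bending Problem `PBP_n` (WKST Problem 6).
* `modularRelation q p x` — the modular relation problem `R^m_{q,p}` of Grilo et al.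
  (Definition 22): `|y| ≡ 0 (mod q) ↔ |x| ≡ 0 (mod p)`; `R_{2,4}` is Parity Halving on its
  promise and `R_{2,3}` is Parity Bending (`parityBendingRel_eq_modularRelation`,
  `mem_parityHalvingRel_iff_mem_modularRelation`).
* `pairAndParity x` — the parity of the number of unordered pairs `{i, j}` with
  `xᵢ = xⱼ = 1` (= the output of one parity gate over all `C(n,2)` two-input `AND` gates);
  `card_firingPairs : #pairs = C(|x|, 2)`, `two_mul_choose_two_mod_two : C(2k,2) ≡ k (mod 2)`,
  `pairAndParity_mem_parityHalvingRel` (the one-hot output string carrying this bit solves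
  `PHP` on every even-weight input), `mem_relaxedParityHalvingRel_of_mem_parityHalvingRel`
  (a `PHP` solution together with `d = 0` solves `RPHP(G)` for every graph `G`).
* `pairAndParity_acRealOver`, `exists_circuit_accBasis_two_solves_parityHalving` — the same bit
  as a circuit in the tree's vocabulary (`Circuit`, `accBasis 2 = {¬, ∧ₖ, ∨ₖ, MOD₂,ₖ}`,
  `acDepth`): one `MOD₂` gate over the `C(n,2)` two-input `∧` gates, `acDepth ≤ 2`,
  `size ≤ C(n,2) + 1`; hence a single-output depth-2 circuit over `accBasis 2` whose one-hot
  output solves `PHP` and (with `d = 0`) every `RPHP(G)` on all even-weight inputs — the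
  `AC⁰[2]` upper bound behind Grilo et al. 2024, Lemma 34 (`R^m_{2,4} ∈ NC⁰[2]`), made explicit.

## Sources

* A. Bene Watts, R. Kothari, L. Schaeffer, A. Tal, *Exponential separation between shallow
  quantum circuits and unbounded fan-in shallow classical circuits*, STOC 2019, arXiv:1906.08890:
  Problems 1, 2, 3, 6 and §1.1 ("if we allowed the output string `y` in PHP to be of quadratic
  size, then there is a simple depth-1 `NC⁰` circuit that solves this problem! The circuit simply
  computes the AND of every pair of input bits … the Hamming weight of this string will be
  `C(|x|, 2)`") [WattsEtAl2019].
* A. B. Grilo, E. Kashefi, D. Markham, M. de Oliveira, *The power of shallow-depth Toffoli and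
  qudit quantum circuits*, arXiv:2404.18104, Definition 22 (modular relation problem) and
  Lemma 34 (`R^m_{q^{k₁}, p^{k₂}}` is solvable in `NC⁰[p]`) [GriloEtAl2024ShallowToffoliQudit].
* S. Grewal, V. M. Kumar, *Improved circuit lower bounds and quantum-classical separations*,
  arXiv:2408.16406v3, Definitions 5.25, 5.35 and §1.3 (open problem: separations between `QNC⁰`
  and `GC⁰(k)[p]` without an advice state) [GrewalKumar2024].

## Design choices

* Strings are `ι → Bool` over arbitrary finite index types (`Fin n` in the sources); the Hamming
  weight `|x|` is Mathlib's `hammingNorm x` for the Boolean ring structure on `Bool`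
  (`0 = false`), i.e. the number of coordinates equal to `true` (`hammingNorm_eq_card_onesFinset`).
* The even-weight PROMISE of Parity Halving is kept outside the relation (as in WKST, where
  circuits are only evaluated on valid inputs): `parityHalvingRel x` is defined for every `x` by
  the printed congruence with `|x|/2` the truncated quotient; statements about solving `PHP`
  quantify over `x` with `Even (hammingNorm x)`.
* A graph `G = (V, E)` is an edge-indexed family `ends : E → V × V` (WKST index `d ∈ {0,1}^E`
  by edges and allow any connected graph; connectivity plays no role in the definition).
* No circuit CLASSES of relation problems are defined here (the tree's `AC0Mod` is a class of
  languages); the `AC⁰[2]` upper bound is stated concretely as the existence of ONE single-output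
  `Circuit ι` over `accBasis 2` with `acDepth ≤ 2` and `size ≤ C(n,2)+1` (via the realizability
  calculus `ACRealOver` of `ACRealizeOver.lean`), whose output bit, written at any coordinate of
  an otherwise-zero output string, is a valid answer. The lower bounds of the cited papers
  (`AC⁰`, `GC⁰(k)`, …) are not restated. What is deliberately NOT here: the quantum circuits,
  `QNC⁰/qpoly`, cat states.
-/

namespace Literature.Computability.QuantumComplexity

open Finset

section Weight

variable {ι : Type*} [Fintype ι]

/-- The set of coordinates of a Boolean string that are `true` (the support of `x` in the Boolean
ring `Bool`). [folklore] -/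
def onesFinset (x : ι → Bool) : Finset ι := univ.filter fun i => x i = true

/-- Membership in `onesFinset`. [folklore] -/
@[simp] private theorem mem_onesFinset (x : ι → Bool) (i : ι) : i ∈ onesFinset x ↔ x i = true := by
  simp [onesFinset]

/-- The Hamming weight "`|x|`" of the sources (WKST 2019, §1.1: "the Hamming weight of `x`,
denoted `|x|`") is Mathlib's `hammingNorm x` for `0 = false`: the number of `true` coordinates.
[cite: WattsEtAl2019, Problem 1] -/
theorem hammingNorm_eq_card_onesFinset (x : ι → Bool) : hammingNorm x = (onesFinset x).card := by
  simp only [hammingNorm, ne_eq, onesFinset]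
  congr 1
  ext i
  simp [show (0 : Bool) = false from rfl]

/-- The overlap `⟨z, x⟩ = Σ_v z_v x_v ∈ ℕ` of two Boolean strings: the number of coordinates where
both are `true` (WKST 2019, Theorem 18: `⟨z, x⟩ := Σ_{i ∈ [n]} z_i · x_i`).
[cite: WattsEtAl2019, Theorem 18] -/
def overlapCount (z x : ι → Bool) : ℕ := (univ.filter fun v => z v = true ∧ x v = true).card

/-- The all-`false` string has overlap `0` with everything. [folklore] -/
@[simp] private theorem overlapCount_false_left (x : ι → Bool) : overlapCount (fun _ => false) x = 0 := by
  simp [overlapCount]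

end Weight

/-! ### The relation problems, as printed -/

section Relations

variable {ι κ : Type*} [Fintype ι] [Fintype κ]

/-- **The Parity Halving Problem** `PHP_{n,m}` (Watts–Kothari–Schaeffer–Tal 2019, Problem 1):
"Given an input `x ∈ {0,1}ⁿ` of even parity, output a string `y ∈ {0,1}ᵐ` such that
`|y| ≡ ½|x| (mod 2)`. Alternately, `y` must have even parity if `|x| ≡ 0 (mod 4)` and odd parity
if `|x| ≡ 2 (mod 4)`." Here: the set of valid outputs `y : κ → Bool` for the input
`x : ι → Bool` (`ι = Fin n`, `κ = Fin m` in the source; `PHP_n := PHP_{n,n}`), with `|x|/2` the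
truncated quotient — the promise `Even (hammingNorm x)` is imposed where the problem is used.
[cite: WattsEtAl2019, Problem 1] -/
def parityHalvingRel (x : ι → Bool) : Set (κ → Bool) :=
  {y | hammingNorm y % 2 = hammingNorm x / 2 % 2}

/-- Unfolding lemma for `parityHalvingRel`. [cite: WattsEtAl2019, Problem 1] -/
theorem mem_parityHalvingRel_iff (x : ι → Bool) (y : κ → Bool) :
    y ∈ parityHalvingRel x ↔ hammingNorm y % 2 = hammingNorm x / 2 % 2 := Iff.rfl

/-- **The Relaxed Parity Halving Problem for a graph `G = (V, E)`** (Watts–Kothari–Schaeffer–Tal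
2019, Problem 2): "Given an input `x ∈ {0,1}^V` promised to have even parity, … output
`y ∈ {0,1}^V` and `d ∈ {0,1}^E`, such that there exists a `z ∈ {0,1}^V` with the property
`∀ (u,v) ∈ E, z_u ⊕ z_v = d_{(u,v)}`, and `|y| ≡ ½|x| + ⟨z, x⟩ (mod 2)`." The graph is given by
the endpoints `ends e = (u, v)` of its edges; the Grid-RPHP (Problem 3) is the instance where
`G` is the fixed low-diameter spanning tree of the `√n × √n` grid. [cite: WattsEtAl2019, Problem 2] -/
def relaxedParityHalvingRel {V E : Type*} [Fintype V] (ends : E → V × V)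
    (x : V → Bool) : Set ((V → Bool) × (E → Bool)) :=
  {yd | ∃ z : V → Bool, (∀ e, (z (ends e).1 ^^ z (ends e).2) = yd.2 e) ∧
      hammingNorm yd.1 % 2 = (hammingNorm x / 2 + overlapCount z x) % 2}

/-- **The Parity Bending Problem** `PBP_n` (Watts–Kothari–Schaeffer–Tal 2019, Problem 6): "Given
an input `x ∈ {0,1}ⁿ`, output a string `y ∈ {0,1}ⁿ` such that `|y| ≡ 0 (mod 2)` if
`|x| ≡ 0 (mod 3)` and `|y| ≡ 1 (mod 2)` otherwise." [cite: WattsEtAl2019, Problem 6] -/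
def parityBendingRel (x : ι → Bool) : Set (κ → Bool) :=
  {y | hammingNorm y % 2 = 0 ↔ hammingNorm x % 3 = 0}

/-- **The modular relation problem** `R^m_{q,p}` (Grilo–Kashefi–Markham–de Oliveira 2024,
Definition 22): `R^m_{q,p}(x) = {y ∈ 𝔽₂ᵐ : |y| ≡ 0 (mod q) iff |x| ≡ 0 (mod p)}` for
`x ∈ {0,1}ⁿ`. (Grewal–Kumar 2024, Definition 5.35, use its `r`-fold parallel repetition with
`p = 2`.) [cite: GriloEtAl2024ShallowToffoliQudit, Definition 22] -/
def modularRelation (q p : ℕ) (x : ι → Bool) : Set (κ → Bool) :=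
  {y | hammingNorm y % q = 0 ↔ hammingNorm x % p = 0}

/-- Parity Bending is the modular relation problem `R_{2,3}` (Grilo et al. 2024, remark after
Definition 22: "[48] … uses `R^{o(n²)}_{2,3}` for their `AC⁰[2]` separation").
[cite: GriloEtAl2024ShallowToffoliQudit, Definition 22] -/
theorem parityBendingRel_eq_modularRelation (x : ι → Bool) :
    (parityBendingRel x : Set (κ → Bool)) = modularRelation 2 3 x := rfl

/-- On its promise (even `|x|`), Parity Halving is the modular relation problem `R_{2,4}`
(Grilo et al. 2024, remark after Definition 22: `R_{2,4}` is the relation of the `NC⁰`/`AC⁰`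
separations; WKST Problem 1: "`y` must have even parity if `|x| ≡ 0 (mod 4)` and odd parity if
`|x| ≡ 2 (mod 4)`"). [cite: GriloEtAl2024ShallowToffoliQudit, Definition 22] -/
theorem mem_parityHalvingRel_iff_mem_modularRelation (x : ι → Bool) (hx : Even (hammingNorm x))
    (y : κ → Bool) : y ∈ parityHalvingRel x ↔ y ∈ (modularRelation 2 4 x : Set (κ → Bool)) := by
  obtain ⟨k, hk⟩ := hx
  simp only [parityHalvingRel, modularRelation, Set.mem_setOf_eq, hk]
  omega

end Relations

/-! ### The pairwise-`AND` parity solves Parity Halving (WKST §1.1) -/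

section PairAnd

variable {ι κ : Type*} [Fintype ι] [Fintype κ] [DecidableEq κ]

/-- The unordered pairs `{i, j}` of coordinates on which both `xᵢ` and `xⱼ` are `true`: the
two-input `AND` gates `xᵢ ∧ xⱼ`, over all `C(n,2)` pairs, that fire on input `x`
(WKST 2019, §1.1). [cite: WattsEtAl2019, §1.1] -/
def firingPairs (x : ι → Bool) : Finset (Finset ι) :=
  (univ.powersetCard 2).filter fun T => ∀ i ∈ T, x i = true

/-- The firing pairs are exactly the `2`-subsets of the support. [cite: WattsEtAl2019, §1.1] -/
theorem firingPairs_eq_powersetCard (x : ι → Bool) :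
    firingPairs x = (onesFinset x).powersetCard 2 := by
  ext T
  simp only [firingPairs, mem_filter, mem_powersetCard, subset_univ, true_and]
  constructor
  · rintro ⟨hcard, hall⟩
    exact ⟨fun i hi => (mem_onesFinset x i).2 (hall i hi), hcard⟩
  · rintro ⟨hsub, hcard⟩
    exact ⟨hcard, fun i hi => (mem_onesFinset x i).1 (hsub hi)⟩

/-- **WKST's count**: the number of pairs `i < j` with `xᵢ = xⱼ = 1` — the Hamming weight of the
string of all pairwise `AND`s — is `C(|x|, 2)` (Watts et al. 2019, §1.1: "the Hamming weight of
this string will be `C(|x|,2)`"). [cite: WattsEtAl2019, §1.1] -/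
theorem card_firingPairs (x : ι → Bool) : (firingPairs x).card = (hammingNorm x).choose 2 := by
  rw [firingPairs_eq_powersetCard, card_powersetCard, hammingNorm_eq_card_onesFinset]

/-- The output bit of ONE unbounded fan-in parity gate over all `C(n,2)` two-input `AND` gates
`xᵢ ∧ xⱼ`: the parity of the number of firing pairs. [cite: WattsEtAl2019, §1.1] -/
def pairAndParity (x : ι → Bool) : Bool := decide (Odd (firingPairs x).card)

/-- `C(2k, 2) = k(2k-1) ≡ k (mod 2)`: on an even-weight input the parity of the pairwise `AND`s
is `|x|/2 mod 2`, the bit Parity Halving asks for (WKST 2019, §1.1: the string of pairwise `AND`s,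
of Hamming weight `C(|x|,2)`, "satisfies the conditions of the problem").
[cite: WattsEtAl2019, §1.1] -/
theorem two_mul_choose_two_mod_two (k : ℕ) : (2 * k).choose 2 % 2 = k % 2 := by
  rcases Nat.eq_zero_or_pos k with rfl | hk
  · simp
  · rw [Nat.choose_two_right]
    have h1 : 2 * k * (2 * k - 1) / 2 = k * (2 * k - 1) := by
      rw [Nat.mul_assoc, Nat.mul_div_cancel_left _ (by norm_num : 0 < 2)]
    rw [h1, Nat.mul_mod]
    have h2 : (2 * k - 1) % 2 = 1 := by omega
    rw [h2, Nat.mul_one, Nat.mod_mod]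

/-- The parity of the pairwise `AND`s of an even-weight string is `|x|/2 mod 2`.
[cite: WattsEtAl2019, §1.1] -/
theorem pairAndParity_eq (x : ι → Bool) (hx : Even (hammingNorm x)) :
    pairAndParity x = decide (hammingNorm x / 2 % 2 = 1) := by
  obtain ⟨k, hk⟩ := hx
  have h2k : hammingNorm x = 2 * k := by omega
  simp only [pairAndParity, card_firingPairs, h2k, Nat.odd_iff, two_mul_choose_two_mod_two,
    Nat.mul_div_cancel_left _ (by norm_num : 0 < 2)]

/-- The one-hot output string carrying the bit `b` at coordinate `j₀` and `false` elsewhere.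
[folklore] -/
def oneHot (j₀ : κ) (b : Bool) : κ → Bool := Function.update (fun _ => false) j₀ b

/-- The Hamming weight of a one-hot string is `1` or `0` according to its bit. [folklore] -/
private theorem hammingNorm_oneHot (j₀ : κ) (b : Bool) : hammingNorm (oneHot j₀ b) = if b then 1 else 0 := by
  cases b
  · have : (oneHot j₀ false : κ → Bool) = fun _ => false := by
      funext j; simp [oneHot, Function.update_apply]
    rw [this]
    exact hammingNorm_zero
  · rw [hammingNorm_eq_card_onesFinset]
    have : onesFinset (oneHot j₀ true) = {j₀} := by
      ext j; simp [oneHot, Function.update_apply, eq_comm]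
    simp [this]

/-- **Parity Halving is solved by one parity gate over the pairwise `AND`s** (the observation of
Watts et al. 2019, §1.1, that the `C(n,2)` pairwise `AND`s have Hamming weight `C(|x|,2)`,
combined with `C(2k,2) ≡ k (mod 2)`): for every input `x` of even Hamming weight and any output
length `m ≥ 1`, the string `y = (pairAndParity x, 0, …, 0)` satisfies `|y| ≡ |x|/2 (mod 2)`,
i.e. `y ∈ PHP(x)`. In circuit terms this `y` is computed by a depth-2 circuit with one layer of
`C(n,2)` fan-in-2 `AND` gates and a single unbounded fan-in parity gate, so `PHP_{n,m}` (and its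
parallel repetition) is solved with certainty by polynomial-size depth-2 `AC⁰[2]` circuits —
the class statement is Grilo et al. 2024, Lemma 34 (`R^m_{2,4} ∈ NC⁰[2]`); WKST prove `PHP`
is hard for `AC⁰` (Theorem 2) and Grier–Schaeffer 2020, §6, ask about `MOD₃` gates.
[cite: WattsEtAl2019, §1.1] -/
theorem pairAndParity_mem_parityHalvingRel (x : ι → Bool) (hx : Even (hammingNorm x)) (j₀ : κ) :
    oneHot j₀ (pairAndParity x) ∈ parityHalvingRel x := by
  rw [mem_parityHalvingRel_iff, hammingNorm_oneHot, pairAndParity_eq x hx]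
  by_cases h : hammingNorm x / 2 % 2 = 1
  · simp [h]
  · have h0 : hammingNorm x / 2 % 2 = 0 := by omega
    simp [h0]

/-- **A Parity Halving solution with the zero side-string solves every Relaxed Parity Halving
Problem** (immediate from WKST Problem 2 with `z = 0^V`, which satisfies `z_u ⊕ z_v = 0 = d_e`
and `⟨z, x⟩ = 0`): if `y ∈ PHP(x)` then `(y, 0^E) ∈ RPHP_G(x)` for every graph `G`. Together with
`pairAndParity_mem_parityHalvingRel`, the Relaxed (and Grid-, and Parallel Grid-) Parity Halving
Problems are solved with certainty by depth-2 polynomial-size `AC⁰[2]` circuits.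
[cite: WattsEtAl2019, Problem 2] -/
theorem mem_relaxedParityHalvingRel_of_mem_parityHalvingRel {V E : Type*} [Fintype V]
    (ends : E → V × V) (x : V → Bool) {y : V → Bool}
    (hy : y ∈ parityHalvingRel x) :
    (y, fun _ => false) ∈ relaxedParityHalvingRel ends x := by
  refine ⟨fun _ => false, fun e => by simp, ?_⟩
  rw [mem_parityHalvingRel_iff] at hy
  simpa [overlapCount_false_left] using hy

/-- The two facts combined: for every graph `G = (V, E)`, every even-weight input `x` and any
vertex `v₀`, the pair `((pairAndParity x at v₀, 0 elsewhere), 0^E)` solves `RPHP_G(x)`.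
[cite: WattsEtAl2019, Problem 2] -/
theorem pairAndParity_mem_relaxedParityHalvingRel {V E : Type*} [Fintype V] [DecidableEq V]
    (ends : E → V × V) (x : V → Bool) (hx : Even (hammingNorm x)) (v₀ : V) :
    (oneHot v₀ (pairAndParity x), fun _ => false) ∈ relaxedParityHalvingRel ends x :=
  mem_relaxedParityHalvingRel_of_mem_parityHalvingRel ends x
    (pairAndParity_mem_parityHalvingRel x hx v₀)

end PairAnd

/-! ### The depth-2 `AC⁰[2]` circuit: one parity gate over the pairwise `AND`s -/

section Circuit

open Literature.Computability.Complexity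

variable {ι : Type*} [Fintype ι] [DecidableEq ι]

/-- `MOD₂` gates of every arity are in `accBasis 2`. [folklore] -/
private theorem modGate_two_mem_accBasis (k : ℕ) : GateFn.modGate 2 k ∈ accBasis 2 :=
  Set.mem_union_right _ (Set.mem_iUnion.2 ⟨k, rfl⟩)

/-- The conjunction of the inputs in a finite set `T` of coordinates is one `∧`-gate of arity
`#T` on input literals: depth `1`, one gate, over any basis containing `acBasis`. [folklore] -/
private theorem acRealOver_and_finset {B : Set GateFn} (hB : acBasis ⊆ B) (T : Finset ι) :
    ACRealOver B (fun x : ι → Bool => decide (∀ i ∈ T, x i = true)) 1 1 := by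
  have h := acRealOver_gate (ι := ι) (B := B) (GateFn.and T.card) (hB (and_mem_acBasis _))
    (f := fun a x => x (T.equivFin.symm a).1) (d := 0) (s := fun _ => 0)
    (fun a => acRealOver_input B _)
  refine (h.mono le_rfl (by simp)).congr fun x => ?_
  change decide (∀ a : Fin T.card, x (T.equivFin.symm a).1 = true) = decide (∀ i ∈ T, x i = true)
  rw [Bool.eq_iff_iff, decide_eq_true_iff, decide_eq_true_iff]
  constructor
  · intro h i hi
    simpa using h (T.equivFin ⟨i, hi⟩)
  · intro h a
    exact h _ (T.equivFin.symm a).2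

/-- **Parity Halving's bit in depth-2 `AC⁰[2]`**: the function `x ↦ pairAndParity x` (the parity
of the number of pairs `{i,j}` with `xᵢ = xⱼ = 1`) is realized over `accBasis 2 = {¬, ∧ₖ, ∨ₖ,
MOD₂,ₖ}` in `acDepth 2` with `C(n,2) + 1` gates: one `MOD₂` gate of fan-in `C(n,2)` reading the
`C(n,2)` two-input `∧`-gates `xᵢ ∧ xⱼ` (the circuit of WKST 2019, §1.1, with its `C(n,2)` outputs
fed into one parity gate). [cite: WattsEtAl2019, §1.1] -/
theorem pairAndParity_acRealOver :
    ACRealOver (accBasis 2) (fun x : ι → Bool => pairAndParity x) 2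
      ((Fintype.card ι).choose 2 + 1) := by
  classical
  set P : Finset (Finset ι) := (univ : Finset ι).powersetCard 2 with hP
  have hPcard : P.card = (Fintype.card ι).choose 2 := by
    rw [hP, card_powersetCard, card_univ]
  -- the AND gates, indexed by `Fin P.card` through `P.equivFin`
  let T : Fin P.card → Finset ι := fun j => (P.equivFin.symm j).1
  have hand : ∀ j, ACRealOver (accBasis 2) (fun x : ι → Bool => decide (∀ i ∈ T j, x i = true)) 1 1 :=
    fun j => acRealOver_and_finset (acBasis_subset_accBasis 2) (T j)
  have hgate := acRealOver_gate (ι := ι) (B := accBasis 2) (GateFn.modGate 2 P.card)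
    (modGate_two_mem_accBasis _) (f := fun j x => decide (∀ i ∈ T j, x i = true)) (d := 1)
    (s := fun _ => 1) hand
  refine (hgate.mono le_rfl (le_of_eq ?_)).congr fun x => ?_
  · simp [hPcard]; rfl
  -- semantics: the MOD₂ gate fires iff the number of firing pairs is odd
  change decide (GateFn.numOnes (fun j => decide (∀ i ∈ T j, x i = true)) % 2 ≠ 0) = pairAndParity x
  have hcount : GateFn.numOnes (fun j => decide (∀ i ∈ T j, x i = true)) = (firingPairs x).card := by
    unfold GateFn.numOnes
    refine card_bij (fun j _ => T j) (fun j hj => ?_) (fun j₁ _ j₂ _ h => ?_) (fun S hS => ?_)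
    · simp only [mem_filter, mem_univ, true_and, decide_eq_true_eq] at hj
      simp only [firingPairs, mem_filter]
      exact ⟨(P.equivFin.symm j).2, hj⟩
    · exact P.equivFin.symm.injective (Subtype.ext h)
    · simp only [firingPairs, mem_filter] at hS
      refine ⟨P.equivFin ⟨S, hS.1⟩, ?_, ?_⟩
      · simp only [mem_filter, mem_univ, true_and, decide_eq_true_eq]
        intro i hi
        have : T (P.equivFin ⟨S, hS.1⟩) = S := by simp [T]
        rw [this] at hi
        exact hS.2 i hi
      · simp [T]
  rw [hcount, pairAndParity, Bool.eq_iff_iff, decide_eq_true_iff, decide_eq_true_iff, Nat.odd_iff]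
  omega

/-- **Parity Halving is solved by a depth-2, size-`C(n,2)+1` circuit over `{¬, ∧, ∨, MOD₂}`**
(kernel form of the kill test "is (Relaxed) Parity Halving in `AC⁰[2]`?"): there is a single-output
circuit `C` over `accBasis 2` with `acDepth C ≤ 2` and `size C ≤ C(n,2) + 1` such that, for every
input `x` of even Hamming weight and every output length with a distinguished coordinate `j₀`,
the one-hot string carrying `C(x)` at `j₀` is a valid Parity Halving output, and together with
`d = 0^E` a valid Relaxed Parity Halving output for every graph on the input coordinates
(WKST 2019, §1.1 + Problem 2; class statement: Grilo et al. 2024, Lemma 34, `R^m_{2,4} ∈ NC⁰[2]`).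
[cite: WattsEtAl2019, §1.1] -/
theorem exists_circuit_accBasis_two_solves_parityHalving :
    ∃ C : Circuit ι, C.IsOver (accBasis 2) ∧ C.acDepth ≤ 2 ∧
      C.size ≤ (Fintype.card ι).choose 2 + 1 ∧
      (∀ {κ : Type*} [Fintype κ] [DecidableEq κ] (j₀ : κ) (x : ι → Bool),
        Even (hammingNorm x) → oneHot j₀ (C.eval x) ∈ parityHalvingRel x) ∧
      (∀ {E : Type*} (ends : E → ι × ι) (v₀ : ι) (x : ι → Bool), Even (hammingNorm x) →
        (oneHot v₀ (C.eval x), fun _ : E => false) ∈ relaxedParityHalvingRel ends x) := by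
  obtain ⟨C, hB, hd, hs, hC⟩ := (pairAndParity_acRealOver (ι := ι)).toCircuit
  refine ⟨C, hB, hd, hs, fun j₀ x hx => ?_, fun ends v₀ x hx => ?_⟩
  · rw [hC x]; exact pairAndParity_mem_parityHalvingRel x hx j₀
  · rw [hC x]; exact pairAndParity_mem_relaxedParityHalvingRel ends x hx v₀

end Circuit

/-! ### Lucas at the second bit for inputs of every weight (the identity behind `PHPCollapse`) -/

section Lucas

variable {ι : Type*} [Fintype ι]

/-- **`C(m,2) ≡ ⌊m/2⌋ (mod 2)` for every `m`** (`C(2k,2) = k(2k-1) ≡ k` and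
`C(2k+1,2) = k(2k+1) ≡ k`; Lucas' theorem read at the second binary digit): the identity behind
"Parity Halving ∈ `AC⁰[2]`" for inputs of ANY weight, not only the even-weight inputs of the
problem's promise (WKST 2019, §1.1 states the even case `C(|x|,2) ≡ |x|/2`; the odd case is the same
computation). [cite: WattsEtAl2019, §1.1] -/
theorem choose_two_mod_two (m : ℕ) : m.choose 2 % 2 = m / 2 % 2 := by
  obtain ⟨k, rfl | rfl⟩ := Nat.even_or_odd' m
  · rw [two_mul_choose_two_mod_two, Nat.mul_div_cancel_left _ (by norm_num : 0 < 2)]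
  · rw [Nat.choose_two_right, Nat.add_sub_cancel]
    have h1 : (2 * k + 1) * (2 * k) / 2 = (2 * k + 1) * k := by
      rw [mul_comm 2 k, ← mul_assoc, Nat.mul_div_cancel _ (by norm_num : 0 < 2)]
    have h2 : (2 * k + 1) / 2 = k := by omega
    rw [h1, h2, Nat.mul_mod, show (2 * k + 1) % 2 = 1 by omega, one_mul, Nat.mod_mod]

/-- The parity of the number of firing pairwise `AND`s is `⌊|x|/2⌋ mod 2` for EVERY input `x`
(even weight: the Parity Halving bit; odd weight `2k+1`: also `k mod 2`).
[cite: WattsEtAl2019, §1.1] -/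
theorem card_firingPairs_mod_two (x : ι → Bool) :
    (firingPairs x).card % 2 = hammingNorm x / 2 % 2 := by
  rw [card_firingPairs, choose_two_mod_two]

/-- Ordered-pair form of WKST's count over a linearly ordered index type (e.g. `Fin n`): the number
of pairs `i < j` with `xᵢ = xⱼ = 1` is `C(|x|, 2)` (the bijection `(i, j) ↦ {i, j}` onto the
`2`-subsets of the support). [cite: WattsEtAl2019, §1.1] -/
theorem card_ltPairs_eq_choose [LinearOrder ι] (x : ι → Bool) :
    (univ.filter fun q : ι × ι => q.1 < q.2 ∧ x q.1 = true ∧ x q.2 = true).card =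
      (hammingNorm x).choose 2 := by
  classical
  rw [← card_firingPairs, firingPairs_eq_powersetCard]
  refine Finset.card_bij (fun q _ => ({q.1, q.2} : Finset ι)) (fun q hq => ?_)
    (fun q hq q' hq' h => ?_) (fun T hT => ?_)
  · simp only [mem_filter, mem_univ, true_and] at hq
    rw [mem_powersetCard]
    refine ⟨fun i hi => ?_, Finset.card_pair (ne_of_lt hq.1)⟩
    rw [mem_onesFinset]
    rcases Finset.mem_insert.1 hi with rfl | hi
    · exact hq.2.1
    · rw [Finset.mem_singleton.1 hi]; exact hq.2.2
  · simp only [mem_filter, mem_univ, true_and] at hq hq'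
    have ha : q.1 ∈ ({q'.1, q'.2} : Finset ι) := h ▸ Finset.mem_insert_self _ _
    have hb : q.2 ∈ ({q'.1, q'.2} : Finset ι) := h ▸ Finset.mem_insert_of_mem (Finset.mem_singleton_self _)
    have ha' : q'.1 ∈ ({q.1, q.2} : Finset ι) := h.symm ▸ Finset.mem_insert_self _ _
    simp only [Finset.mem_insert, Finset.mem_singleton] at ha hb ha'
    have h1 : q.1 = q'.1 := by
      rcases ha with ha | ha
      · exact ha
      · rcases ha' with ha' | ha'
        · exact ha'.symm
        · exact absurd (ha' ▸ ha ▸ hq'.1) (lt_asymm hq.1)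
    have h2 : q.2 = q'.2 := by
      rcases hb with hb | hb
      · exact absurd (hb ▸ h1 ▸ hq.1) (lt_irrefl _)
      · exact hb
    exact Prod.ext h1 h2
  · rw [mem_powersetCard] at hT
    obtain ⟨a, b, hab, rfl⟩ := Finset.card_eq_two.1 hT.2
    have ha : x a = true := (mem_onesFinset x a).1 (hT.1 (Finset.mem_insert_self _ _))
    have hb : x b = true :=
      (mem_onesFinset x b).1 (hT.1 (Finset.mem_insert_of_mem (Finset.mem_singleton_self _)))
    rcases lt_or_gt_of_ne hab with h | h
    · exact ⟨(a, b), by simp [h, ha, hb], rfl⟩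
    · exact ⟨(b, a), by simp [h, ha, hb], Finset.pair_comm _ _⟩

/-- **`PHPCollapse` in closed form**: for every Boolean string on a linearly ordered index type,
`#{(i,j) : i < j, xᵢ = xⱼ = 1} ≡ ⌊|x|/2⌋ (mod 2)` — the single parity gate over the pairwise `AND`s
outputs `⌊|x|/2⌋ mod 2` on ALL inputs. [cite: WattsEtAl2019, §1.1] -/
theorem card_ltPairs_mod_two [LinearOrder ι] (x : ι → Bool) :
    (univ.filter fun q : ι × ι => q.1 < q.2 ∧ x q.1 = true ∧ x q.2 = true).card % 2 =
      (univ.filter fun i : ι => x i = true).card / 2 % 2 := by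
  rw [card_ltPairs_eq_choose, choose_two_mod_two, hammingNorm_eq_card_onesFinset]
  rfl

end Lucas

end Literature.Computability.QuantumComplexity
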